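import Summits.QuantumFields.YangMills.Theorems.SwapVirialDeficitBlowUpGnomonicStratumBSeamCoords
import Summits.QuantumFields.YangMills.Theorems.SwapVirialDeficitBlowUpGnomonicStratumBEtaCoercivity
import HarnessLib

/-!
# THE DIAGONAL B-POINT FLOOR: every letter direction of the B-fibre is stiff off the crossing — `k_x|u|²x₀′² + k_y(…) + |z′|²/(12150L⁶) + k_FΣ|η_f′|² ≤ Q_B(d)`
# (free-hands support of ⟨stmt-QuantumFields-24197⟩ `SwapVirialDeficit.SwapGluedStiffness`; region (Rd) of LEAD g98's skeleton ➎ — ✓`fibre_raySecond_ge_stratumB_eta` ⊕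
# ✓`fibre_raySecond_ge_stratumB_seam_coords` with the `z′`-coupling of the seam absorbed, weights `109/110 ∕ 1/110`)

* `coupling_sq_le` (`(z₀′ + (u₂z₁′ − u₁z₂′))² ≤ 2(1+|u|²)|z′|²`);
* ★★★ `fibre_raySecond_ge_stratumB_diag (ha) (hre) (ε) (hz) (hε) (u₁ u₂ d)`:
  `|u|²·x₀′²/(12375L⁶(1+|u|²)²) + (109/165)·[(‖a‖⁻¹‖im a‖)²·4(y₁′²+y₂′²)/16200L⁶ + 2Σ_f|η_f′|²/(2304L⁶|Fol L|) + ((u₁y₂′−u₂y₁′)² + (u₂y₀′)² + (u₁y₀′)²)/(450L⁶(1+|u|²))]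
   + |z′|²/(12150L⁶) ≤ (d²/ds²)F̂(η_B + s·ξ_B(d))|₀`.
So at a stratum-B point with base letter `u ≠ 0` EVERY letter direction `(x₀′, y′, z′, η_F′)` of the B-fibre is stiff, with coefficients `≳ |u|²/((1+|u|²)²P(L))` — the only soft fibre
direction left is the hub-polar angle `δ` (a ray in the hub variable `a`, sequel), and everything degenerates exactly on `Σ = {u = 0}` (LEAD memo5 §2 (Rd)).

HONEST LABEL: arithmetic on landed floors; regions' stiffness, ⟨24197⟩ ∕ ⟨24194⟩ ∕ ⟨24497⟩ OPEN; own crux ⟨22884⟩ OPEN (blocked-on ⟨19935⟩); the Yang–Mills mass gap is NOT proved;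
no summit is proved by a line.  THEOREMS ONLY (0 `def`, 0 `sorry`), standard axioms.  Width seat ym-line-sfw-p2-w3 g66 (cell ym-idea-1, free hands),
`--supports stmt-QuantumFields-24197`.  References: [cite: Luscher1983, §2]; [folklore].
-/

set_option autoImplicit false

noncomputable section

open MeasureTheory Quaternion
open scoped BigOperators Quaternion
open Literature.MathematicalPhysics.QuantumFieldTheory hiding SU2
open Literature.MathematicalPhysics.QuantumLattice

namespace Summit.QuantumFields.YangMills.Theorems.SwapVirialDeficit.BlowUpRing

open Summit.QuantumFields.YangMills.Theorems.FemtoTransferGap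
open Summit.QuantumFields.YangMills.Theorems.SwapVirialDeficit.Gnomonic (normSq3 normSq3_nonneg)

variable {L : ℕ} [NeZero L]

omit [NeZero L] in
/-- The seam's `z′`-coupling is controlled by `|z′|²`: `(z₀′ + (u₂z₁′ − u₁z₂′))² ≤ 2(1+|u|²)|z′|²`. [folklore] -/
theorem coupling_sq_le (u₁ u₂ : ℝ) (z : Fin 3 → ℝ) :
    (z 0 + (u₂ * z 1 - u₁ * z 2)) ^ 2 ≤ 2 * (1 + (u₁ ^ 2 + u₂ ^ 2)) * normSq3 z := by
  simp only [normSq3, Fin.sum_univ_three]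
  nlinarith [sq_nonneg (z 0 - (u₂ * z 1 - u₁ * z 2)), sq_nonneg (u₁ * z 1 + u₂ * z 2), sq_nonneg (z 0), sq_nonneg (u₁ * z 0), sq_nonneg (u₂ * z 0)]

set_option maxHeartbeats 800000 in
/-- ★★★ **THE DIAGONAL B-POINT FLOOR** (end hub `a ≠ 0`, `re a = 0`; `ε_z = +`, followers `+`). [cite: Luscher1983, §2] -/
theorem fibre_raySecond_ge_stratumB_diag {a : ℍ} (ha : a ≠ 0) (hre : a.re = 0) (ε : GnoSign L) (hz : ε.2.1 = true) (hε : ε.2.2 = fun _ => true)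
    (u₁ u₂ : ℝ) (d : ℝ × (Fin 3 → ℝ) × (Fin 3 → ℝ) × (Fol L → Fin 3 → ℝ)) :
    (u₁ ^ 2 + u₂ ^ 2) * d.1 ^ 2 / (12375 * (L : ℝ) ^ 6 * (1 + (u₁ ^ 2 + u₂ ^ 2)) ^ 2) +
        109 / 165 * ((‖a‖⁻¹ * ‖a.im‖) ^ 2 * (4 * (d.2.1 1 ^ 2 + d.2.1 2 ^ 2)) / (16200 * (L : ℝ) ^ 6) +
          (∑ f, 2 * normSq3 (d.2.2.2 f)) / (2304 * (L : ℝ) ^ 6 * (Fintype.card (Fol L) : ℝ)) +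
          ((u₁ * d.2.1 2 - u₂ * d.2.1 1) ^ 2 + (u₂ * d.2.1 0) ^ 2 + (u₁ * d.2.1 0) ^ 2) / (450 * (L : ℝ) ^ 6 * (1 + (u₁ ^ 2 + u₂ ^ 2)))) +
        normSq3 d.2.2.1 / (12150 * (L : ℝ) ^ 6) ≤
      iteratedDeriv 2 (fun s : ℝ => gnoDeficit (fun _ => false) (fun _ => 1) a ε
        (((((![0, u₁, u₂] : Fin 3 → ℝ), (0 : Fin 3 → ℝ)), ((0 : Fin 3 → ℝ), (0 : Fol L → Fin 3 → ℝ))) : GnoCoord L) +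
          s • ((((![d.1, 0, 0] : Fin 3 → ℝ), d.2.1), (d.2.2.1, d.2.2.2)) : GnoCoord L))) 0 := by
  have hL : (0 : ℝ) < L := by exact_mod_cast NeZero.pos L
  have h1 := fibre_raySecond_ge_stratumB_eta (L := L) ha hre ε hz hε u₁ u₂ d
  have h2 := fibre_raySecond_ge_stratumB_seam_coords (L := L) ha hre ε hz hε u₁ u₂ d
  obtain ⟨Q, hQ⟩ : ∃ Q : ℝ, Q = iteratedDeriv 2 (fun s : ℝ => gnoDeficit (fun _ => false) (fun _ => 1) a ε
        (((((![0, u₁, u₂] : Fin 3 → ℝ), (0 : Fin 3 → ℝ)), ((0 : Fin 3 → ℝ), (0 : Fol L → Fin 3 → ℝ))) : GnoCoord L) +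
          s • ((((![d.1, 0, 0] : Fin 3 → ℝ), d.2.1), (d.2.2.1, d.2.2.2)) : GnoCoord L))) 0 := ⟨_, rfl⟩
  rw [← hQ] at h1 h2 ⊢
  -- scalar names
  obtain ⟨U, hU⟩ : ∃ t : ℝ, t = u₁ ^ 2 + u₂ ^ 2 := ⟨_, rfl⟩
  obtain ⟨Nz, hNz⟩ : ∃ t : ℝ, t = normSq3 d.2.2.1 := ⟨_, rfl⟩
  obtain ⟨q, hq⟩ : ∃ t : ℝ, t = d.2.2.1 0 + (u₂ * d.2.2.1 1 - u₁ * d.2.2.1 2) := ⟨_, rfl⟩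
  have hU0 : 0 ≤ U := by rw [hU]; positivity
  have hNz0 : 0 ≤ Nz := by rw [hNz]; exact normSq3_nonneg _
  have hq2 : q ^ 2 ≤ 2 * (1 + U) * Nz := by rw [hq, hU, hNz]; exact coupling_sq_le u₁ u₂ d.2.2.1
  -- weaken the seam floor: drop the first square, open the second
  have hD : (0 : ℝ) < 225 * (L : ℝ) ^ 6 * (1 + U) ^ 2 := by positivity
  have hsq : 2 * d.1 ^ 2 - q ^ 2 ≤ (2 * d.1 + q) ^ 2 := by nlinarith [sq_nonneg (2 * d.1 + 2 * q)]
  have hnum : U * (2 * d.1 ^ 2 - 2 * (1 + U) * Nz) ≤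
      (U * d.2.2.1 0 - (u₂ * d.2.2.1 1 - u₁ * d.2.2.1 2)) ^ 2 + U * (2 * d.1 + d.2.2.1 0 + (u₂ * d.2.2.1 1 - u₁ * d.2.2.1 2)) ^ 2 := by
    have e : 2 * d.1 + d.2.2.1 0 + (u₂ * d.2.2.1 1 - u₁ * d.2.2.1 2) = 2 * d.1 + q := by rw [hq]; ring
    rw [e]
    nlinarith [sq_nonneg (U * d.2.2.1 0 - (u₂ * d.2.2.1 1 - u₁ * d.2.2.1 2)), mul_le_mul_of_nonneg_left hsq hU0,
      mul_le_mul_of_nonneg_left hq2 hU0]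
  have h2' : U * (2 * d.1 ^ 2 - 2 * (1 + U) * Nz) / (225 * (L : ℝ) ^ 6 * (1 + U) ^ 2) ≤ Q := by
    have h2u : ((U * d.2.2.1 0 - (u₂ * d.2.2.1 1 - u₁ * d.2.2.1 2)) ^ 2 + U * (2 * d.1 + d.2.2.1 0 + (u₂ * d.2.2.1 1 - u₁ * d.2.2.1 2)) ^ 2) /
        (225 * (L : ℝ) ^ 6 * (1 + U) ^ 2) ≤ Q := by rw [hU]; exact h2
    exact le_trans (div_le_div_of_nonneg_right hnum hD.le) h2u
  -- split and bound the `z` part of the weakened seam floor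
  have hsplit : U * (2 * d.1 ^ 2 - 2 * (1 + U) * Nz) / (225 * (L : ℝ) ^ 6 * (1 + U) ^ 2) =
      2 * U * d.1 ^ 2 / (225 * (L : ℝ) ^ 6 * (1 + U) ^ 2) - U / (1 + U) * (2 * Nz / (225 * (L : ℝ) ^ 6)) := by
    have h1U : (1 + U) ≠ 0 := by positivity
    have hL6 : (L : ℝ) ^ 6 ≠ 0 := by positivity
    field_simp
  have hfrac : U / (1 + U) ≤ 1 := by rw [div_le_one (by positivity)]; linarith only [hU0]
  have hZpart : U / (1 + U) * (2 * Nz / (225 * (L : ℝ) ^ 6)) ≤ 2 * Nz / (225 * (L : ℝ) ^ 6) := by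
    have hz' : 0 ≤ 2 * Nz / (225 * (L : ℝ) ^ 6) := by positivity
    calc U / (1 + U) * (2 * Nz / (225 * (L : ℝ) ^ 6)) ≤ 1 * (2 * Nz / (225 * (L : ℝ) ^ 6)) := mul_le_mul_of_nonneg_right hfrac hz'
      _ = 2 * Nz / (225 * (L : ℝ) ^ 6) := one_mul _
  rw [hsplit] at h2'
  -- the η-floor with the names
  have h1' : 2 / 3 * ((((‖a‖⁻¹ * ‖a.im‖) ^ 2 * (4 * (d.2.1 1 ^ 2 + d.2.1 2 ^ 2)) + 4 * Nz) / (16200 * (L : ℝ) ^ 6)) +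
      (∑ f, 2 * normSq3 (d.2.2.2 f)) / (2304 * (L : ℝ) ^ 6 * (Fintype.card (Fol L) : ℝ)) +
      ((u₁ * d.2.1 2 - u₂ * d.2.1 1) ^ 2 + (u₂ * d.2.1 0) ^ 2 + (u₁ * d.2.1 0) ^ 2) / (450 * (L : ℝ) ^ 6 * (1 + U))) ≤ Q := by
    rw [hNz, hU]; exact h1
  -- combine with weights `109/110` and `1/110`
  have hcomb : 109 / 110 * (2 / 3 * ((((‖a‖⁻¹ * ‖a.im‖) ^ 2 * (4 * (d.2.1 1 ^ 2 + d.2.1 2 ^ 2)) + 4 * Nz) / (16200 * (L : ℝ) ^ 6)) +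
      (∑ f, 2 * normSq3 (d.2.2.2 f)) / (2304 * (L : ℝ) ^ 6 * (Fintype.card (Fol L) : ℝ)) +
      ((u₁ * d.2.1 2 - u₂ * d.2.1 1) ^ 2 + (u₂ * d.2.1 0) ^ 2 + (u₁ * d.2.1 0) ^ 2) / (450 * (L : ℝ) ^ 6 * (1 + U)))) +
      1 / 110 * (2 * U * d.1 ^ 2 / (225 * (L : ℝ) ^ 6 * (1 + U) ^ 2) - U / (1 + U) * (2 * Nz / (225 * (L : ℝ) ^ 6))) ≤ Q := by
    linarith only [h1', h2']
  -- identify the target's coefficients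
  rw [← hU, ← hNz]
  have eX : U * d.1 ^ 2 / (12375 * (L : ℝ) ^ 6 * (1 + U) ^ 2) = 1 / 110 * (2 * U * d.1 ^ 2 / (225 * (L : ℝ) ^ 6 * (1 + U) ^ 2)) := by
    have hd1 : (12375 * (L : ℝ) ^ 6 * (1 + U) ^ 2) ≠ 0 := by positivity
    have hd2 : (225 * (L : ℝ) ^ 6 * (1 + U) ^ 2) ≠ 0 := by positivity
    rw [mul_div_assoc', div_eq_div_iff hd1 hd2]
    ring
  have eZ : Nz / (12150 * (L : ℝ) ^ 6) = 109 / 110 * (2 / 3 * (4 * Nz / (16200 * (L : ℝ) ^ 6))) - 1 / 110 * (2 * Nz / (225 * (L : ℝ) ^ 6)) := by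
    have hL6 : (L : ℝ) ^ 6 ≠ 0 := by positivity
    field_simp
    ring
  have eH : 109 / 165 * ((‖a‖⁻¹ * ‖a.im‖) ^ 2 * (4 * (d.2.1 1 ^ 2 + d.2.1 2 ^ 2)) / (16200 * (L : ℝ) ^ 6) +
      (∑ f, 2 * normSq3 (d.2.2.2 f)) / (2304 * (L : ℝ) ^ 6 * (Fintype.card (Fol L) : ℝ)) +
      ((u₁ * d.2.1 2 - u₂ * d.2.1 1) ^ 2 + (u₂ * d.2.1 0) ^ 2 + (u₁ * d.2.1 0) ^ 2) / (450 * (L : ℝ) ^ 6 * (1 + U))) +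
      109 / 110 * (2 / 3 * (4 * Nz / (16200 * (L : ℝ) ^ 6))) =
      109 / 110 * (2 / 3 * ((((‖a‖⁻¹ * ‖a.im‖) ^ 2 * (4 * (d.2.1 1 ^ 2 + d.2.1 2 ^ 2)) + 4 * Nz) / (16200 * (L : ℝ) ^ 6)) +
      (∑ f, 2 * normSq3 (d.2.2.2 f)) / (2304 * (L : ℝ) ^ 6 * (Fintype.card (Fol L) : ℝ)) +
      ((u₁ * d.2.1 2 - u₂ * d.2.1 1) ^ 2 + (u₂ * d.2.1 0) ^ 2 + (u₁ * d.2.1 0) ^ 2) / (450 * (L : ℝ) ^ 6 * (1 + U)))) := by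
    ring
  rw [eX, eZ]
  linarith only [hcomb, hZpart, eH]

end Summit.QuantumFields.YangMills.Theorems.SwapVirialDeficit.BlowUpRing

end
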